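import Mathlib
import Summits.Langlands.Langlands.Theorems.PicardMuOrdinaryResidualAutomorphyOddCore
import Summits.Langlands.Langlands.Theorems.PicardMuOrdinaryResidualAutomorphyOddTable
import HarnessLib

/-!
# Per-prime algebra for `ResidualAutomorphyOdd` (helper for item stmt-Langlands-13759, route PicardMuOrdinary)

At a good prime `𝔭` of `K = ℚ(ω)` over `p`, of residue degree `1` or `2`: the Hecke polynomials of the
base change to `K` of the twisted adjoint lift, as polynomials over `ℤ̄`, and their reductions modulo a
maximal ideal above `3`, matched with the reduced polynomials `redPoly₁` / `redPoly₂` of the Frobenius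
trace and determinant of `ρ̄_g` and with the route's table (`perPrime`).
-/

set_option linter.dupNamespace false -- project-wide option (lakefile weak.linter.dupNamespace); `Summit.Langlands.Langlands` is the mandated namespace

noncomputable section

open scoped NumberField Classical Polynomial MatrixGroups
open Filter IsDedekindDomain Polynomial
open Literature.NumberTheory.Automorphic Literature.NumberTheory.GaloisRepresentations
open Literature.NumberTheory.EllipticCurves.ModularForms

namespace Summit.Langlands.Langlands.Theorems.ResidualAutomorphyOdd

section Core

variable {N : ℕ} [NeZero N] {w : ℕ}

/-! ### Per-prime algebra -/

section PerPrime

/-- The degree-one Hecke identity `x/y + y/x + 1` in terms of `a = x + y`, `xy = ε P`. -/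
theorem sum_prod_identity {x y c ε P a : ℂ} (hε : ε ≠ 0) (hc : c ^ 2 = 1) (hxy : x + y = a)
    (hxy' : x * y = ε * P) :
    c * x ^ 2 * ε⁻¹ + c * y ^ 2 * ε⁻¹ = c * (a ^ 2 * ε⁻¹ - 2 * P) ∧
      (c * x ^ 2 * ε⁻¹) * (c * y ^ 2 * ε⁻¹) = P ^ 2 := by
  constructor
  · have : x ^ 2 + y ^ 2 = a ^ 2 - 2 * (ε * P) := by rw [← hxy, ← hxy']; ring
    calc c * x ^ 2 * ε⁻¹ + c * y ^ 2 * ε⁻¹ = c * ε⁻¹ * (x ^ 2 + y ^ 2) := by ring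
      _ = c * (a ^ 2 * ε⁻¹ - 2 * P) := by rw [this]; field_simp
  · calc (c * x ^ 2 * ε⁻¹) * (c * y ^ 2 * ε⁻¹) = c ^ 2 * (x * y) ^ 2 * ε⁻¹ ^ 2 := by ring
      _ = P ^ 2 := by rw [hc, hxy']; field_simp

/-- The degree-two Hecke identity (squares of the parameters). -/
theorem sum_prod_identity_sq {x y c ε P a : ℂ} (hε : ε ≠ 0) (hc : c ^ 2 = 1) (hxy : x + y = a)
    (hxy' : x * y = ε * P) :
    (c * x ^ 2 * ε⁻¹) ^ 2 + (c * y ^ 2 * ε⁻¹) ^ 2 = (a ^ 2 * ε⁻¹ - 2 * P) ^ 2 - 2 * P ^ 2 ∧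
      (c * x ^ 2 * ε⁻¹) ^ 2 * (c * y ^ 2 * ε⁻¹) ^ 2 = P ^ 4 := by
  obtain ⟨h1, h2⟩ := sum_prod_identity hε hc hxy hxy'
  constructor
  · have : (c * x ^ 2 * ε⁻¹) ^ 2 + (c * y ^ 2 * ε⁻¹) ^ 2 =
        (c * x ^ 2 * ε⁻¹ + c * y ^ 2 * ε⁻¹) ^ 2 - 2 * ((c * x ^ 2 * ε⁻¹) * (c * y ^ 2 * ε⁻¹)) := by ring
    rw [this, h1, h2]
    calc (c * (a ^ 2 * ε⁻¹ - 2 * P)) ^ 2 - 2 * P ^ 2 = c ^ 2 * (a ^ 2 * ε⁻¹ - 2 * P) ^ 2 - 2 * P ^ 2 := by ring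
      _ = _ := by rw [hc, one_mul]
  · calc (c * x ^ 2 * ε⁻¹) ^ 2 * (c * y ^ 2 * ε⁻¹) ^ 2 = ((c * x ^ 2 * ε⁻¹) * (c * y ^ 2 * ε⁻¹)) ^ 2 := by ring
      _ = P ^ 4 := by rw [h2]; ring

/-- The expanded product of the three linear factors attached to a three-element multiset. -/
theorem prod_map_X_sub_C_triple {R : Type*} [CommRing R] (u₁ u₂ u₃ : R) :
    (({u₁, u₂, u₃} : Multiset R).map fun z => X - C z).prod =
      X ^ 3 - C (u₁ + u₂ + u₃) * X ^ 2 + C (u₁ * u₂ + u₁ * u₃ + u₂ * u₃) * X - C (u₁ * u₂ * u₃) := by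
  simp only [Multiset.insert_eq_cons, Multiset.map_cons, Multiset.map_singleton, Multiset.prod_cons,
    Multiset.prod_singleton, map_add, map_mul]
  ring

/-- Squares of a three-element multiset. -/
theorem map_sq_triple {R : Type*} [CommRing R] (u₁ u₂ u₃ : R) :
    (({u₁, u₂, u₃} : Multiset R).map fun z => z ^ 2) = {u₁ ^ 2, u₂ ^ 2, u₃ ^ 2} := by
  simp [Multiset.insert_eq_cons]

/-- Expansion of the cubic `(X - c₁)(X² - c₂ X + c₃)`. -/
theorem cubic_expand {R : Type*} [CommRing R] (c₁ c₂ c₃ : R) :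
    (X - C c₁) * (X ^ 2 - C c₂ * X + C c₃) =
      X ^ 3 - C (c₁ + c₂) * X ^ 2 + C (c₃ + c₁ * c₂) * X - C (c₁ * c₃) := by
  simp only [map_add, map_mul]
  ring

variable {N : ℕ} [NeZero N] {w : ℕ}

/-- The table polynomial on `𝓞 K ⧸ 𝔭` is the route's literal case expression. -/
theorem tablePoly_eq (f : ℤ[X]) (𝔭 : HeightOneSpectrum (𝓞 Kω)) :
    tablePoly (𝓞 Kω ⧸ 𝔭.asIdeal) f = (if (f.map ((Ideal.Quotient.mk 𝔭.asIdeal).comp (algebraMap ℤ (NumberField.RingOfIntegers (CyclotomicField 3 ℚ))))).roots.toFinset.card = 4 then (Polynomial.X - 1) ^ 3 else if (f.map ((Ideal.Quotient.mk 𝔭.asIdeal).comp (algebraMap ℤ (NumberField.RingOfIntegers (CyclotomicField 3 ℚ))))).roots.toFinset.card = 2 then (Polynomial.X - 1) ^ 2 * (Polynomial.X + 1) else if (f.map ((Ideal.Quotient.mk 𝔭.asIdeal).comp (algebraMap ℤ (NumberField.RingOfIntegers (CyclotomicField 3 ℚ))))).roots.toFinset.card = 1 then Polynomial.X ^ 3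 - 1 else if (∃ y : ((NumberField.RingOfIntegers (CyclotomicField 3 ℚ)) ⧸ 𝔭.asIdeal), y ^ 2 = (f.map ((Ideal.Quotient.mk 𝔭.asIdeal).comp (algebraMap ℤ (NumberField.RingOfIntegers (CyclotomicField 3 ℚ))))).discr) then (Polynomial.X - 1) * (Polynomial.X + 1) ^ 2 else Polynomial.X ^ 3 + Polynomial.X ^ 2 + Polynomial.X + 1 : Polynomial ℤ) := by
  have hhom : (Ideal.Quotient.mk 𝔭.asIdeal).comp (algebraMap ℤ (𝓞 Kω)) =
      Int.castRingHom (𝓞 Kω ⧸ 𝔭.asIdeal) := RingHom.ext_int _ _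
  simp only [tablePoly, hhom]

set_option maxHeartbeats 1600000 in
/-- The per-prime computation: the integral Hecke polynomial `Q` at a good place `𝔭` and its
reduction modulo `𝔐`. -/
theorem perPrime (f : ℤ[X]) {σ : FramedGaloisRep ℚ K3 2}
    {ω : Literature.NumberTheory.GaloisRepresentations.HeckeCharacter ℚ} {s : ℕ → ℤˣ} {S : Finset ℕ}
    (hωs : ∀ p (hp : p.Prime), p ∉ S → ω.valueAtUniformizer (placeOf p hp) = ((s p : ℤ) : ℂ))
    (htab : ∀ p (hp : p.Prime), p ∉ S → ∀ 𝔓 ∈ (placeOf p hp).primesAbove, ∀ Φ : Field.absoluteGaloisGroup ℚ,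
        IsArithFrobAt (𝓞 ℚ) Φ 𝔓 → ∀ (F : Type) [CommRing F] [IsDomain F] [Fintype F],
          (Fintype.card F = p →
            redPoly₁ (Matrix.trace ((σ Φ : GL (Fin 2) K3) : Matrix (Fin 2) (Fin 2) K3))
              (Matrix.det ((σ Φ : GL (Fin 2) K3) : Matrix (Fin 2) (Fin 2) K3)) ((s p : ℤ) : K3) =
            (tablePoly F f).map (Int.castRingHom K3)) ∧
          (Fintype.card F = p ^ 2 →
            redPoly₂ (Matrix.trace ((σ Φ : GL (Fin 2) K3) : Matrix (Fin 2) (Fin 2) K3))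
              (Matrix.det ((σ Φ : GL (Fin 2) K3) : Matrix (Fin 2) (Fin 2) K3)) =
            (tablePoly F f).map (Int.castRingHom K3)))
    {g : CuspForm (CongruenceSubgroup.Gamma1 N) (w : ℤ)} {ιg : coeffCharIntegers g →+* K3} (hw : 2 ≤ w)
    (hρ : IsGaloisRepOfNewform1Int g ιg {q : ℕ | q ∣ N * 3} σ)
    {𝔐 : Ideal Zbar} (h𝔐 : 𝔐.comap (toZbar g) = RingHom.ker ιg)
    {𝔭 : HeightOneSpectrum (𝓞 Kω)} {α : Multiset ℂ} {x y : ℂ} {v : HeightOneSpectrum (𝓞 ℚ)}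
    (hunder : 𝔭.asIdeal.under (𝓞 ℚ) = v.asIdeal)
    (hpS : ((Rat.HeightOneSpectrum.primesEquiv v : Nat.Primes) : ℕ) ∉ S)
    (hpN : ¬ ((Rat.HeightOneSpectrum.primesEquiv v : Nat.Primes) : ℕ) ∣ N * 3)
    (hxy : x + y = (UpperHalfPlane.qExpansion 1 ⇑g).coeff (Rat.HeightOneSpectrum.primesEquiv v))
    (hxy' : x * y = (nebentypus g ((Rat.HeightOneSpectrum.primesEquiv v : ℕ) : ZMod N) : ℂ) *
            ((Rat.HeightOneSpectrum.primesEquiv v : ℕ) : ℂ) ^ (w - 1))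
    (hε : (nebentypus g ((Rat.HeightOneSpectrum.primesEquiv v : ℕ) : ZMod N) : ℂ) ≠ 0)
    (hα : α.map (fun a => (𝔭.residueCard : ℂ) * a) =
            ({ω.valueAtUniformizer v * x ^ 2 * ((nebentypus g ((Rat.HeightOneSpectrum.primesEquiv v : ℕ) : ZMod N) : ℂ))⁻¹,
              ω.valueAtUniformizer v * y ^ 2 * ((nebentypus g ((Rat.HeightOneSpectrum.primesEquiv v : ℕ) : ZMod N) : ℂ))⁻¹,
              ω.valueAtUniformizer v * ((Rat.HeightOneSpectrum.primesEquiv v : ℕ) : ℂ) ^ (w - 1)} : Multiset ℂ).map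
              (fun z => z ^ 𝔭.asIdeal.inertiaDeg (𝓞 ℚ))) :
    ∃ Q : Polynomial Zbar,
      Q.map (algebraMap Zbar ℂ) = (α.map (fun a => Polynomial.X - Polynomial.C ((𝔭.residueCard : ℂ) * a))).prod ∧
      Q.map (Ideal.Quotient.mk 𝔐) = (if (f.map ((Ideal.Quotient.mk 𝔭.asIdeal).comp (algebraMap ℤ (NumberField.RingOfIntegers (CyclotomicField 3 ℚ))))).roots.toFinset.card = 4 then (Polynomial.X - 1) ^ 3 else if (f.map ((Ideal.Quotient.mk 𝔭.asIdeal).comp (algebraMap ℤ (NumberField.RingOfIntegers (CyclotomicField 3 ℚ))))).roots.toFinset.card = 2 then (Polynomial.X - 1) ^ 2 * (Polynomial.X + 1) else if (f.map ((Ideal.Quotient.mk 𝔭.asIdeal).comp (algebraMap ℤ (NumberField.RingOfIntegers (CyclotomicField 3 ℚ))))).roots.toFinset.card = 1 then Polynomial.X ^ 3 - 1 else if (∃ y : ((NumberField.RingOfIntegers (CyclotomicField 3 ℚ)) ⧸ 𝔭.asIdeal), y ^ 2 = (f.map ((Ideal.Quotient.mk 𝔭.asIdeal).comp (algebraMap ℤ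 (NumberField.RingOfIntegers (CyclotomicField 3 ℚ))))).discr) then (Polynomial.X - 1) * (Polynomial.X + 1) ^ 2 else Polynomial.X ^ 3 + Polynomial.X ^ 2 + Polynomial.X + 1 : Polynomial ℤ).map (Int.castRingHom ((integralClosure ℤ ℂ) ⧸ 𝔐)) := by
  classical
  set p : ℕ := ((Rat.HeightOneSpectrum.primesEquiv v : Nat.Primes) : ℕ) with hpdef
  have hp : p.Prime := (Rat.HeightOneSpectrum.primesEquiv v).2
  have hv : placeOf p hp = v := by
    have : (⟨p, hp⟩ : Nat.Primes) = Rat.HeightOneSpectrum.primesEquiv v := Subtype.ext rfl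
    simp only [placeOf, this, Equiv.symm_apply_apply]
  -- Frobenius at `v` and the Hecke data
  obtain ⟨𝔓, h𝔓⟩ := HeightOneSpectrum.primesAbove_nonempty v
  obtain ⟨Φ, hΦ⟩ := HeightOneSpectrum.exists_isArithFrobAt_of_mem_primesAbove_holds h𝔓
  obtain ⟨a, b, hta, hdb, haC, hbC⟩ := frob_trace_det hρ v hpN h𝔓 hΦ
  -- residue-field data
  have h3 := three_not_mem hunder hpN
  obtain ⟨he1, he2, hNp, hpe⟩ := residue_data hunder h3
  haveI : Finite (𝓞 Kω ⧸ 𝔭.asIdeal) := Ideal.finiteQuotientOfFreeOfNeBot 𝔭.asIdeal 𝔭.ne_bot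
  letI : Fintype (𝓞 Kω ⧸ 𝔭.asIdeal) := Fintype.ofFinite _
  have hcard : Fintype.card (𝓞 Kω ⧸ 𝔭.asIdeal) = p ^ 𝔭.asIdeal.inertiaDeg (𝓞 ℚ) := by
    rw [Fintype.card_eq_nat_card, ← HeightOneSpectrum.residueCard_eq_card_quotient, hNp]
  have h𝔓' : 𝔓 ∈ (placeOf p hp).primesAbove := by rw [hv]; exact h𝔓
  obtain ⟨htab₁, htab₂⟩ := htab p hp hpS 𝔓 h𝔓' Φ hΦ (𝓞 Kω ⧸ 𝔭.asIdeal)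
  -- the root of unity `ε(p)` as an element of `𝓞_g`
  set εp : ℂ := (nebentypus g (p : ZMod N) : ℂ) with hεpdef
  set m : ℕ := Fintype.card (ZMod N)ˣ with hmdef
  have hm : 0 < m := Fintype.card_pos
  have hcop : p.Coprime N :=
    (Nat.Prime.coprime_iff_not_dvd hp).2 fun h => hpN (dvd_mul_of_dvd_left h 3)
  have hεpm : εp ^ m = 1 := nebentypus_pow_card_units g hcop
  let e0 : coeffCharField g := ⟨εp, nebentypus_mem_coeffCharField g p⟩
  have he0m : e0 ^ m = 1 := by
    apply Subtype.ext
    simp [e0, hεpm]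
  let eO : coeffCharIntegers g := ⟨e0, IsIntegral.of_pow hm (by rw [he0m]; exact isIntegral_one)⟩
  have heOm : eO ^ m = 1 := by
    apply Subtype.ext
    simp [eO, he0m]
  set einv : coeffCharIntegers g := eO ^ (m - 1) with heinvdef
  have heinv : eO * einv = 1 := by rw [heinvdef, ← pow_succ', Nat.sub_add_cancel hm, heOm]
  set pw : coeffCharIntegers g := (p : coeffCharIntegers g) ^ (w - 1) with hpwdef
  set sO : coeffCharIntegers g := ((s p : ℤ) : coeffCharIntegers g) with hsOdef
  -- images in `ℂ`
  set φC : coeffCharIntegers g →+* ℂ := (algebraMap Zbar ℂ).comp (toZbar g) with hφCdef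
  have hφC : ∀ z, φC z = ((z : coeffCharField g) : ℂ) := fun z => rfl
  have hφa : φC a = x + y := by rw [hφC, haC, hxy]
  have hφe : φC eO = εp := rfl
  have hφeinv : φC einv = εp⁻¹ := by
    have h := congrArg φC heinv
    rw [map_mul, map_one, hφe] at h
    exact (eq_inv_of_mul_eq_one_right h)
  have hφpw : φC pw = (p : ℂ) ^ (w - 1) := by simp [hpwdef]
  have hφs : φC sO = ((s p : ℤ) : ℂ) := by simp [hsOdef]
  have hcs : ω.valueAtUniformizer v = ((s p : ℤ) : ℂ) := by rw [← hv]; exact hωs p hp hpS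
  have hs2Z : ((s p : ℤ)) ^ 2 = 1 := by
    rw [← Units.val_pow_eq_pow_val, Int.units_sq, Units.val_one]
  have hs2 : (((s p : ℤ)) : ℂ) ^ 2 = 1 := by
    have h := congrArg (fun z : ℤ => (z : ℂ)) hs2Z
    push_cast at h
    exact h
  have hs2K : (((s p : ℤ)) : K3) ^ 2 = 1 := by
    have h := congrArg (fun z : ℤ => (z : K3)) hs2Z
    push_cast at h
    exact h
  have hzpow : ((p : ℂ)) ^ ((w : ℤ) - 1) = (p : ℂ) ^ (w - 1) := by
    rw [show ((w : ℤ) - 1) = ((w - 1 : ℕ) : ℤ) by omega, zpow_natCast]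
  have hxy'' : x * y = εp * (p : ℂ) ^ (w - 1) := hxy'
  -- images in `𝔽̄₃`
  set t : K3 := Matrix.trace ((σ Φ : GL (Fin 2) K3) : Matrix (Fin 2) (Fin 2) K3) with htdef
  set d : K3 := Matrix.det ((σ Φ : GL (Fin 2) K3) : Matrix (Fin 2) (Fin 2) K3) with hddef
  have hd0 : d ≠ 0 := by
    rw [hddef, ← Matrix.GeneralLinearGroup.val_det_apply]
    exact Units.ne_zero _
  have hb_eq : b = eO * pw := by
    apply algebraMap_coeffCharIntegers_injective g
    apply Subtype.ext
    change ((b : coeffCharField g) : ℂ) = φC (eO * pw)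
    rw [hbC, map_mul, hφe, hφpw, hzpow]
  set ē : K3 := ιg eO with hēdef
  set π : K3 := ιg pw with hπdef
  have hιd : ē * π = d := by rw [hēdef, hπdef, ← map_mul, ← hb_eq]; exact hdb.symm
  have hē0 : ē ≠ 0 := fun h => hd0 (by rw [← hιd, h, zero_mul])
  have hπ0 : π ≠ 0 := fun h => hd0 (by rw [← hιd, h, mul_zero])
  have hιeinv : ιg einv = ē⁻¹ := by
    have h := congrArg ιg heinv
    rw [map_mul, map_one] at h
    exact (eq_inv_of_mul_eq_one_right h)
  have hπp : π = ((p : K3)) ^ (w - 1) := by simp [hπdef, hpwdef]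
  have hιs : ιg sO = ((s p : ℤ) : K3) := by simp [hsOdef]
  have hιa : ιg a = t := hta.symm
  -- the multiset of scaled Satake parameters
  have hmap : (α.map fun a => Polynomial.X - Polynomial.C ((𝔭.residueCard : ℂ) * a)) =
      ((({((s p : ℤ) : ℂ) * x ^ 2 * εp⁻¹, ((s p : ℤ) : ℂ) * y ^ 2 * εp⁻¹,
          ((s p : ℤ) : ℂ) * (p : ℂ) ^ (w - 1)} : Multiset ℂ).map
          (fun z => z ^ 𝔭.asIdeal.inertiaDeg (𝓞 ℚ))).map fun z => X - C z) := by
    rw [← hcs, ← hα, Multiset.map_map]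
    rfl
  clear_value pw sO einv
  rcases (show 𝔭.asIdeal.inertiaDeg (𝓞 ℚ) = 1 ∨ 𝔭.asIdeal.inertiaDeg (𝓞 ℚ) = 2 by omega) with he | he
  · -- residue degree one: `p ≡ 1 (mod 3)`
    have hp1 : (p : K3) = 1 := by simpa [he] using hpe
    have hπ1 : π = 1 := by rw [hπp, hp1, one_pow]
    have hēd : ē = d := by rw [← hιd, hπ1, mul_one]
    set Q₀ : (coeffCharIntegers g)[X] :=
      (X - C (sO * pw)) * (X ^ 2 - C (sO * (a ^ 2 * einv - 2 * pw)) * X + C (pw ^ 2)) with hQ₀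
    refine ⟨Q₀.map (toZbar g), ?_, ?_⟩
    · rw [Polynomial.map_map, hmap, he]
      simp only [pow_one, Multiset.map_id']
      rw [prod_map_X_sub_C_triple]
      obtain ⟨hsum, hprod⟩ := sum_prod_identity (a := x + y) (P := (p : ℂ) ^ (w - 1)) hε hs2 rfl hxy''
      change Q₀.map φC = _
      have hc₁ : φC (sO * pw) = ((s p : ℤ) : ℂ) * (p : ℂ) ^ (w - 1) := by rw [map_mul, hφs, hφpw]
      have hc₂ : φC (sO * (a ^ 2 * einv - 2 * pw)) =
          ((s p : ℤ) : ℂ) * ((x + y) ^ 2 * εp⁻¹ - 2 * (p : ℂ) ^ (w - 1)) := by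
        rw [map_mul, hφs, map_sub, map_mul, map_pow, hφa, hφeinv, map_mul, map_ofNat, hφpw]
      have hc₃ : φC (pw ^ 2) = ((p : ℂ) ^ (w - 1)) ^ 2 := by rw [map_pow, hφpw]
      simp only [hQ₀, Polynomial.map_mul, Polynomial.map_sub, Polynomial.map_add, Polynomial.map_pow,
        Polynomial.map_X, Polynomial.map_C, hc₁, hc₂, hc₃]
      rw [cubic_expand]
      have eA : ((s p : ℤ) : ℂ) * (p : ℂ) ^ (w - 1) + ((s p : ℤ) : ℂ) * ((x + y) ^ 2 * εp⁻¹ - 2 * (p : ℂ) ^ (w - 1)) =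
          ((s p : ℤ) : ℂ) * x ^ 2 * εp⁻¹ + ((s p : ℤ) : ℂ) * y ^ 2 * εp⁻¹ + ((s p : ℤ) : ℂ) * (p : ℂ) ^ (w - 1) := by
        linear_combination (-1 : ℂ) * hsum
      have eB : ((p : ℂ) ^ (w - 1)) ^ 2 +
            ((s p : ℤ) : ℂ) * (p : ℂ) ^ (w - 1) * (((s p : ℤ) : ℂ) * ((x + y) ^ 2 * εp⁻¹ - 2 * (p : ℂ) ^ (w - 1))) =
          ((s p : ℤ) : ℂ) * x ^ 2 * εp⁻¹ * (((s p : ℤ) : ℂ) * y ^ 2 * εp⁻¹) +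
            ((s p : ℤ) : ℂ) * x ^ 2 * εp⁻¹ * (((s p : ℤ) : ℂ) * (p : ℂ) ^ (w - 1)) +
            ((s p : ℤ) : ℂ) * y ^ 2 * εp⁻¹ * (((s p : ℤ) : ℂ) * (p : ℂ) ^ (w - 1)) := by
        linear_combination (-1 : ℂ) * hprod + (-(((s p : ℤ) : ℂ) * (p : ℂ) ^ (w - 1))) * hsum
      have eD : ((s p : ℤ) : ℂ) * (p : ℂ) ^ (w - 1) * ((p : ℂ) ^ (w - 1)) ^ 2 =
          ((s p : ℤ) : ℂ) * x ^ 2 * εp⁻¹ * (((s p : ℤ) : ℂ) * y ^ 2 * εp⁻¹) * (((s p : ℤ) : ℂ) * (p : ℂ) ^ (w - 1)) := by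
        linear_combination (-(((s p : ℤ) : ℂ) * (p : ℂ) ^ (w - 1))) * hprod
      rw [eA, eB, eD]
    · apply map_map_mk_eq_of_map_eq ιg (toZbar g) 𝔐 h𝔐
      have hk₁ : ιg (sO * pw) = ((s p : ℤ) : K3) * π := by rw [map_mul, hιs]
      have hk₂ : ιg (sO * (a ^ 2 * einv - 2 * pw)) = ((s p : ℤ) : K3) * (t ^ 2 * ē⁻¹ - 2 * π) := by
        rw [map_mul, hιs, map_sub, map_mul, map_pow, hιa, hιeinv, map_mul, map_ofNat]
      have hk₃ : ιg (pw ^ 2) = π ^ 2 := by rw [map_pow]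
      have hQ : Q₀.map ιg = redPoly₁ t d ((s p : ℤ) : K3) := by
        simp only [hQ₀, Polynomial.map_mul, Polynomial.map_sub, Polynomial.map_add, Polynomial.map_pow,
          Polynomial.map_X, Polynomial.map_C, hk₁, hk₂, hk₃]
        rw [hπ1, hēd, redPoly₁]
        simp only [mul_one, one_pow, map_one, div_eq_mul_inv]
      rw [hQ, htab₁ (by rw [hcard, he, pow_one]), tablePoly_eq]
  · -- residue degree two: `p ≡ 2 (mod 3)`
    have hp2 : (p : K3) ^ 2 = 1 := by simpa [he] using hpe
    have hπ2 : π ^ 2 = 1 := by rw [hπp, ← pow_mul, mul_comm, pow_mul, hp2, one_pow]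
    have hēinv : ē⁻¹ = π * d⁻¹ := by
      have : ē = d * π := by
        calc ē = ē * π ^ 2 := by rw [hπ2, mul_one]
          _ = d * π := by rw [sq, ← mul_assoc, hιd]
      rw [this, mul_inv, mul_comm]
      congr 1
      exact (inv_eq_of_mul_eq_one_right (by rw [← sq, hπ2]))
    set Q₀ : (coeffCharIntegers g)[X] :=
      (X - C (pw ^ 2)) * (X ^ 2 - C ((a ^ 2 * einv - 2 * pw) ^ 2 - 2 * pw ^ 2) * X + C (pw ^ 4)) with hQ₀
    refine ⟨Q₀.map (toZbar g), ?_, ?_⟩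
    · rw [Polynomial.map_map, hmap, he, map_sq_triple, prod_map_X_sub_C_triple]
      obtain ⟨hsum, hprod⟩ := sum_prod_identity_sq (a := x + y) (P := (p : ℂ) ^ (w - 1)) hε hs2 rfl hxy''
      change Q₀.map φC = _
      have hc₁ : φC (pw ^ 2) = ((p : ℂ) ^ (w - 1)) ^ 2 := by rw [map_pow, hφpw]
      have hc₂ : φC ((a ^ 2 * einv - 2 * pw) ^ 2 - 2 * pw ^ 2) =
          ((x + y) ^ 2 * εp⁻¹ - 2 * (p : ℂ) ^ (w - 1)) ^ 2 - 2 * ((p : ℂ) ^ (w - 1)) ^ 2 := by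
        rw [map_sub, map_pow, map_sub, map_mul, map_pow, hφa, hφeinv, map_mul, map_ofNat, hφpw, map_mul,
          map_ofNat, map_pow, hφpw]
      have hc₃ : φC (pw ^ 4) = ((p : ℂ) ^ (w - 1)) ^ 4 := by rw [map_pow, hφpw]
      simp only [hQ₀, Polynomial.map_mul, Polynomial.map_sub, Polynomial.map_add, Polynomial.map_pow,
        Polynomial.map_X, Polynomial.map_C, hc₁, hc₂, hc₃]
      have hu₃ : (((s p : ℤ) : ℂ) * (p : ℂ) ^ (w - 1)) ^ 2 = ((p : ℂ) ^ (w - 1)) ^ 2 := by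
        rw [mul_pow, hs2, one_mul]
      rw [hu₃, cubic_expand]
      have eA : ((p : ℂ) ^ (w - 1)) ^ 2 + (((x + y) ^ 2 * εp⁻¹ - 2 * (p : ℂ) ^ (w - 1)) ^ 2 - 2 * ((p : ℂ) ^ (w - 1)) ^ 2) =
          (((s p : ℤ) : ℂ) * x ^ 2 * εp⁻¹) ^ 2 + (((s p : ℤ) : ℂ) * y ^ 2 * εp⁻¹) ^ 2 + ((p : ℂ) ^ (w - 1)) ^ 2 := by
        linear_combination (-1 : ℂ) * hsum
      have eB : ((p : ℂ) ^ (w - 1)) ^ 4 +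
            ((p : ℂ) ^ (w - 1)) ^ 2 * (((x + y) ^ 2 * εp⁻¹ - 2 * (p : ℂ) ^ (w - 1)) ^ 2 - 2 * ((p : ℂ) ^ (w - 1)) ^ 2) =
          (((s p : ℤ) : ℂ) * x ^ 2 * εp⁻¹) ^ 2 * (((s p : ℤ) : ℂ) * y ^ 2 * εp⁻¹) ^ 2 +
            (((s p : ℤ) : ℂ) * x ^ 2 * εp⁻¹) ^ 2 * ((p : ℂ) ^ (w - 1)) ^ 2 +
            (((s p : ℤ) : ℂ) * y ^ 2 * εp⁻¹) ^ 2 * ((p : ℂ) ^ (w - 1)) ^ 2 := by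
        linear_combination (-1 : ℂ) * hprod + (-(((p : ℂ) ^ (w - 1)) ^ 2)) * hsum
      have eD : ((p : ℂ) ^ (w - 1)) ^ 2 * ((p : ℂ) ^ (w - 1)) ^ 4 =
          (((s p : ℤ) : ℂ) * x ^ 2 * εp⁻¹) ^ 2 * (((s p : ℤ) : ℂ) * y ^ 2 * εp⁻¹) ^ 2 * ((p : ℂ) ^ (w - 1)) ^ 2 := by
        linear_combination (-(((p : ℂ) ^ (w - 1)) ^ 2)) * hprod
      rw [eA, eB, eD]
    · apply map_map_mk_eq_of_map_eq ιg (toZbar g) 𝔐 h𝔐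
      have hk₁ : ιg (pw ^ 2) = π ^ 2 := by rw [map_pow]
      have hk₂ : ιg ((a ^ 2 * einv - 2 * pw) ^ 2 - 2 * pw ^ 2) = (t ^ 2 * ē⁻¹ - 2 * π) ^ 2 - 2 * π ^ 2 := by
        rw [map_sub, map_pow, map_sub, map_mul, map_pow, hιa, hιeinv, map_mul, map_ofNat, map_mul, map_ofNat,
          map_pow]
      have hk₃ : ιg (pw ^ 4) = π ^ 4 := by rw [map_pow]
      have h1 : t ^ 2 * ē⁻¹ - 2 * π = π * (t ^ 2 / d - 2) := by rw [hēinv, div_eq_mul_inv]; ring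
      have h4 : π ^ 4 = 1 := by rw [show (4 : ℕ) = 2 * 2 by norm_num, pow_mul, hπ2, one_pow]
      have hQ : Q₀.map ιg = redPoly₂ t d := by
        simp only [hQ₀, Polynomial.map_mul, Polynomial.map_sub, Polynomial.map_add, Polynomial.map_pow,
          Polynomial.map_X, Polynomial.map_C, hk₁, hk₂, hk₃]
        rw [h1, mul_pow, hπ2, one_mul, h4, map_one, redPoly₂, mul_one]
      rw [hQ, htab₂ (by rw [hcard, he]), tablePoly_eq]

end PerPrime

end Core

end Summit.Langlands.Langlands.Theorems.ResidualAutomorphyOdd
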